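import Summits.QuantumFields.BalabanUV.T4Continuum.Support.LineAveragingPairing
import Summits.QuantumFields.BalabanUV.T4Continuum.Support.CovariantBlockAveragingTower
import Summits.QuantumFields.BalabanUV.T4Continuum.Support.GramPerturbationLaw
import Summits.QuantumFields.BalabanUV.T4Continuum.Support.ScalarBlockPoincare
import Summits.QuantumFields.BalabanUV.T4Continuum.Support.FirstOrderAdjointModel
import Literature.MathematicalPhysics.QuantumFieldTheory.Balaban1983to89.B5DeltaA169
import Literature.MathematicalPhysics.QuantumFieldTheory.Balaban1983to89.B5Adjoint176

/-!
# T⁴ programme, spine node NE2 (U1a), tier B rows B3.a′ ∕ B3.d — THE FREE INNER-PAIRING LAW OF BAŁABAN's (1.18) AVERAGING: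
# `‖B_k‖ ≤ 1`, `‖B_{k+1}J_k − B_k‖ ≤ L^{−k}`, `‖(B_{k+1}J_k − B_k)(Δ_a^{(k)})⁻¹‖ ≤ Cst·L^{−k}`; `averagingLaws_Bfree`

NE2 formalisation swarm `b2b-balaban-t4-ne2-formalise-*`, seat leaf-06 (file 2 of 2; file 1 = `Support/LineAveragingPairing`, the exact
identity `√(L^d)·Q_{L·n}J_L = Q_n(1 + c_L(S_1 − 1))`).  The two data the row owner's GRAM SHAPE `GramPerturbationLaw.AveragingLaws D B J b f`
(journal l.5387 (B); rows B3.a′ ∕ B3.d of `t4/formal/NE2/LEAVES.md`, owner ruling R3 l.5825) asks of the INNER averagings `B_k` — the size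
«‖B_k‖ ≤ b» and the SANDWICHED two-level pairings «‖(B_{k+1}J_k − B_k)D_k⁻¹‖, ‖D_k⁻¹(B_{k+1}J_k − B_k)ᴴ‖ ≤ f_k» — DISCHARGED for Bałaban's
own `k`-fold (1.18) averaging at `U = 1` with `b = 1`, `f_k = Cst(d,a)·L^{−k}`, for the colour-lifted `Bfree L M k = √(n_k^d)•(QvOp (lev L k) M ⊗ₖ 1)`
of leaf-07's `Support/CovariantBlockAveragingTower` (imported BY NAME, no restatement):

 * §1 one level `n`: `QsOp_apply'`, `QsOp_mul_conjTranspose` (`Q′Q′ᴴ = n^{−d}·1`: the blocks (1.6) partition the torus),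
   `opNorm_QsOp_le` (`‖Q′‖ ≤ n^{−d/2}`); **`QvOp_mul_shiftT_sub_one`**: `Q_n(S_1 − 1) = n⁻¹·(S_1^{unit} − 1)(Q′_n ⊗ 1)` EXACTLY (the contour
   sum of `S_1f − f` telescopes to the NEXT block, «x(b) is a point in B^k(b₊)»), hence **`opNorm_QvOp_mul_shiftT_sub_one_le`**
   `‖Q_n(S_1 − 1)‖ ≤ 2n⁻¹·n^{−d/2}`; the normalised `Bav n M := √(n^d)•QvOp n M`, **`opNorm_Bav_le`** `≤ 1` (leaf-07's `opNorm_QvOp_le`),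
   **`conjTranspose_Bav_mul_Bav`** `BᴴB = Q*Q` with B5's weighted adjoint `B5DeltaA169.QvAdj` (the `aQ*Q` summand of `Δ_a` (1.69) IS
   `a·BᴴB`), **`Bav_succ_mul_JK_sub`** `B_{Ln}J_L − B_n = c_L·B_n(S_1 − 1)` (file 1) and **`opNorm_Bav_succ_mul_JK_sub_le`**
   `‖B_{Ln}J_L − B_n‖ ≤ n⁻¹` — the pairing defect is `O(η)` in operator norm with NO sandwich (`|c_L| ≤ ½`);
 * §2 along the tower `n_k = L^k`: `BavT L M k := Bav (lev L k) M : Matrix (Tor M × Fin d) (idx L M k) ℂ`, `opNorm_BavT_le`,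
   `conjTranspose_BavT_mul_BavT`, `BavT_succ_mul_JpcT_sub`, **`opNorm_BavT_succ_mul_JpcT_sub_le`** `≤ L^{−k}`, the sandwiched laws
   **`opNorm_pairing_defect_calDalev_le`** ∕ **`opNorm_calDalev_inv_mul_pairing_defect_le`** `≤ Cst·L^{−k}` ((1.89) `‖𝒢‖ ≤ Cst`,
   `KingPairingPlantedLaw.opNorm_inv_calDalev_le`; `𝒢` Hermitian), **`averagingLaws_BavT`** (unlifted), and — after `Bfree_eq_kron :
   Bfree L M k = BavT L M k ⊗ₖ 1` — the row's END **`averagingLaws_Bfree : AveragingLaws (fun k => calDalev L M a ha k ⊗ₖ 1) (Bfree L M)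
   (fun k => JpcT L M k ⊗ₖ 1) 1 (fun k => Cst d a * ((L:ℝ)⁻¹)^k)`**.

HONEST FRAMING (T4-DAG p. 1).  `U = 1`, FIXED finite torus, linear layer, operator norm; statements and constants OURS ([folklore]); the
`[cite:]` tags locate printed OBJECTS ((1.6), (1.18), (1.20), (1.69), (1.83), (1.89)).  ONE input of row B3.b of the NE2 skeleton (the others:
the transport error's size ε — row B3.a — and its two-level consistency δ — rows B3.b-conc ∕ NE3's currency via `Support/NE2FromNE3`); NOT
[B9] (3.26) as printed, NOT NE2, no background field, no conditional of the cell; NOT infinite volume, NOT a mass gap, NOT Clay, NOT summit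
progress; spine 0/9 unchanged.  HONEST DEPENDENCY: continuum YM on T⁴ ⇐ BetaPertH ∧ nine spine estimates (0/9 proved); BetaPertH ⇐ (D1) ∧
(D4) ∧ CAP+tail; G-an2-4 gates asym, D1 and NE2/3/4.  ABSOLUTE RULE kept; no `sorry`.
-/

noncomputable section

open scoped BigOperators ComplexConjugate Matrix Matrix.Norms.L2Operator Kronecker
open Finset

namespace Summit.QuantumFields.BalabanUV.T4Continuum.LineAveragingPairing

open Literature.MathematicalPhysics.QuantumFieldTheory.Balaban1983to89.B5Prop11Plancherel
open Literature.MathematicalPhysics.QuantumFieldTheory.Balaban1983to89.B5Block118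
open Literature.MathematicalPhysics.QuantumFieldTheory.Balaban1983to89.B5Blocks16 (blockOf blockOf_bpt sum_blocks)
open Literature.MathematicalPhysics.QuantumFieldTheory.Balaban1983to89.B5Adjoint176 (sum_ite_bpt)
open Literature.MathematicalPhysics.QuantumFieldTheory.Balaban1983to89.B5G183RateTorus (opNorm_le_of_offDiag_eq_zero)
open Literature.MathematicalPhysics.QuantumFieldTheory.Balaban1983to89.B5DeltaA169 (QvAdj)
open Literature.MathematicalPhysics.QuantumFieldTheory.Balaban1983to89.B5G183RateUnitTower (lev lev_neZero)
open Summit.QuantumFields.BalabanUV.T4Continuum.BalabanLineAverage (shiftT shiftT_eq_iff Lavg opNorm_Lavg_le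
  opNorm_shiftT_one_sub_one_mul_le)
open Summit.QuantumFields.BalabanUV.T4Continuum.KingPairingPlantedLaw (JK JpcT calDalev calDalev_inv)
open Summit.QuantumFields.BalabanUV.T4Continuum.BalabanAveragedTowerUnit (idx one_le_lev' cast_lev')
open Summit.QuantumFields.BalabanUV.T4Continuum.KroneckerLift (opNorm_kron_le kron_mul kron_inv sub_kronecker kron_conjTranspose)
open Summit.QuantumFields.BalabanUV.T4Continuum.CovariantBlockAveraging (opNorm_QvOp_le sqrtVol Bfree opNorm_Bfree_le)
open Summit.QuantumFields.BalabanUV.T4Continuum.GramPerturbationLaw (AveragingLaws)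
open Summit.QuantumFields.BalabanUV.T4Continuum.ScalarBlockPoincare (QsOp_apply_blockOf)
open Summit.QuantumFields.BalabanUV.T4Continuum.FirstOrderAdjointModel (conjTranspose_inv_calDalev)

variable {d : ℕ}

/-! ## §1 One level: the block average `Q′`, the boundary term `Q_n(S_1 − 1)`, the normalised `B_n = √(n^d)·Q_n` -/

section Norm

variable (n L : ℕ) [NeZero n] [NeZero L] (M : Fin d → ℕ) [hM : ∀ μ, NeZero (M μ)]

/-- row sums of the block average against a test function: `Σ_z (Q′)_{yz} g(z) = n^{−d} Σ_j g(ny + j)`. [cite: Balaban1984PropagatorsI,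
(1.20) p.20] [folklore] -/
theorem QsOp_apply' (y : Tor M) (g : Tor (fine n M) → ℂ) : ∑ z, QsOp n M y z * g z = 1 / (n : ℂ) ^ d * ∑ j : Fin d → Fin n, g (bpt n M y j) := by
  have h := QsOp_mulVec n M g y
  rw [Matrix.mulVec, dotProduct] at h
  exact h

/-- every block has `n^d` sites: `Σ_x [x ∈ B^k(y)]·c = n^d·c`. [cite: Balaban1984PropagatorsI, (1.6) p.18] [folklore] -/
theorem sum_ite_blockOf (y : Tor M) (c : ℂ) : ∑ x : Tor (fine n M), (if blockOf n M x = y then c else 0) = (n : ℂ) ^ d * c := by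
  rw [sum_blocks n M (fun x => if blockOf n M x = y then c else 0)]
  simp only [blockOf_bpt, sum_const, card_univ, Fintype.card_fun, Fintype.card_fin, smul_ite, smul_zero,
    sum_ite_eq', mem_univ, if_true, nsmul_eq_mul]
  push_cast
  ring

/-- `Q′ Q′ᴴ = n^{−d}·1`: distinct blocks are disjoint, each has `n^d` sites. [folklore] -/
theorem QsOp_mul_conjTranspose : QsOp n M * (QsOp n M)ᴴ = (((n : ℂ) ^ d)⁻¹) • (1 : Matrix (Tor M) (Tor M) ℂ) := by
  ext y y'
  rw [Matrix.mul_apply, Matrix.smul_apply, smul_eq_mul]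
  have e : ∀ x, QsOp n M y x * (QsOp n M)ᴴ x y'
      = if blockOf n M x = y then (if blockOf n M x = y' then 1 / (n : ℂ) ^ d * (1 / (n : ℂ) ^ d) else 0) else 0 := by
    intro x
    rw [Matrix.conjTranspose_apply, QsOp_apply_blockOf, QsOp_apply_blockOf]
    split_ifs <;> simp
  simp_rw [e]
  by_cases h : y = y'
  · subst h
    rw [Matrix.one_apply_eq, mul_one]
    have e2 : ∀ x, (if blockOf n M x = y then (if blockOf n M x = y then 1 / (n : ℂ) ^ d * (1 / (n : ℂ) ^ d) else 0) else 0)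
        = if blockOf n M x = y then 1 / (n : ℂ) ^ d * (1 / (n : ℂ) ^ d) else 0 := by
      intro x; split_ifs <;> rfl
    simp_rw [e2]
    rw [sum_ite_blockOf]
    have hn : (n : ℂ) ^ d ≠ 0 := pow_ne_zero _ (by exact_mod_cast NeZero.ne n)
    field_simp
  · rw [Matrix.one_apply_ne h, mul_zero]
    refine Finset.sum_eq_zero fun x _ => ?_
    split_ifs with h1 h2
    · exact absurd (h1.symm.trans h2) h
    · rfl
    · rfl

/-- `‖Q′_k‖ ≤ n^{−d/2}`. [folklore] -/
theorem opNorm_QsOp_le : ‖QsOp n M‖ ≤ (Real.sqrt ((n : ℝ) ^ d))⁻¹ := by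
  have hnpos : (0 : ℝ) < (n : ℝ) ^ d := pow_pos (by exact_mod_cast Nat.pos_of_ne_zero (NeZero.ne n)) d
  have hsq : ‖QsOp n M‖ ^ 2 ≤ ((n : ℝ) ^ d)⁻¹ := by
    rw [sq, ← Matrix.l2_opNorm_conjTranspose (QsOp n M), ← Matrix.l2_opNorm_conjTranspose_mul_self,
      Matrix.conjTranspose_conjTranspose, QsOp_mul_conjTranspose]
    refine opNorm_le_of_offDiag_eq_zero _ (le_of_lt (inv_pos.mpr hnpos)) (fun i j hij => ?_) (fun i => ?_)
    · rw [Matrix.smul_apply, Matrix.one_apply_ne hij, smul_zero]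
    · rw [Matrix.smul_apply, Matrix.one_apply_eq, smul_eq_mul, mul_one, norm_inv, norm_pow]
      simp
  rw [← Real.sqrt_inv]
  exact (Real.le_sqrt (norm_nonneg _) (le_of_lt (inv_pos.mpr hnpos))).mpr hsq

/-- the componentwise lift of a scalar block operator acts component by component: `((A ⊗ 1)f)(y, μ) = Σ_z A_{yz} f(z, μ)`. [folklore] -/
theorem kron_one_mulVec {α β : Type*} [Fintype β] (A : Matrix α β ℂ) (f : β × Fin d → ℂ) (y : α) (μ : Fin d) :
    ((A ⊗ₖ (1 : Matrix (Fin d) (Fin d) ℂ)) *ᵥ f) (y, μ) = ∑ z, A y z * f (z, μ) := by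
  rw [Matrix.mulVec, dotProduct, Fintype.sum_prod_type]
  refine Finset.sum_congr rfl fun z _ => ?_
  simp only [Matrix.kroneckerMap_apply, Matrix.one_apply, mul_ite, mul_one, mul_zero, ite_mul, zero_mul]
  rw [Finset.sum_ite_eq]
  simp

/-- the own-direction translation on fields of any torus: `(S_t f)(x, μ) = f(x + t e_μ, μ)`. [folklore] -/
theorem shiftT_mulVec' (Nf : Fin d → ℕ) [∀ μ, NeZero (Nf μ)] (t : ℕ) (f : Tor Nf × Fin d → ℂ) (i : Tor Nf × Fin d) :
    (shiftT Nf t *ᵥ f) i = f (i.1 + tstep Nf i.2 t, i.2) := by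
  simp only [Matrix.mulVec, dotProduct, shiftT, ite_mul, one_mul, zero_mul]
  rw [Finset.sum_ite_eq']
  simp

/-- **THE BOUNDARY TERM IS A UNIT-LATTICE DIFFERENCE OF BLOCK AVERAGES**: `Q_n(S_1 − 1) = n⁻¹·(S_1^{unit} − 1)(Q′_n ⊗ 1)` — summing
`S_1f − f` along the straight contour of `n` fine bonds telescopes to the NEXT block ((1.18): «x(b) is a point in B^k(b₊)»).
[cite: Balaban1984PropagatorsI, (1.18), (1.20) p.20] [folklore] -/
theorem QvOp_mul_shiftT_sub_one :
    QvOp n M * (shiftT (fine n M) 1 - 1) = ((n : ℂ))⁻¹ • ((shiftT M 1 - 1) * (QsOp n M ⊗ₖ (1 : Matrix (Fin d) (Fin d) ℂ))) := by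
  have hnc : (n : ℂ) ≠ 0 := by exact_mod_cast NeZero.ne n
  rw [Matrix.ext_iff_mulVec]
  intro f
  funext b
  obtain ⟨y, μ⟩ := b
  rw [← Matrix.mulVec_mulVec, Matrix.sub_mulVec, Matrix.one_mulVec, QvOp_mulVec]
  simp only [lineSum_shiftT_sub, bpt_add_tstep, tstep_zero, add_zero]
  rw [Matrix.smul_mulVec, Pi.smul_apply, smul_eq_mul, ← Matrix.mulVec_mulVec, Matrix.sub_mulVec, Matrix.one_mulVec,
    Pi.sub_apply, shiftT_mulVec', BalabanLineAverage.tstep_one, kron_one_mulVec, kron_one_mulVec]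
  simp only [QsOp_apply']
  rw [Finset.sum_sub_distrib]
  field_simp
  ring

/-- `‖Q_n(S_1 − 1)‖ ≤ 2·n⁻¹·n^{−d/2}` — the pairing defect of (1.18) is `O(η)` in operator norm WITHOUT any sandwich. [folklore] -/
theorem opNorm_QvOp_mul_shiftT_sub_one_le :
    ‖QvOp n M * (shiftT (fine n M) 1 - 1)‖ ≤ ((n : ℝ))⁻¹ * (2 * (Real.sqrt ((n : ℝ) ^ d))⁻¹) := by
  have hn0 : (0 : ℝ) ≤ ((n : ℝ))⁻¹ := inv_nonneg.mpr (Nat.cast_nonneg _)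
  have h1 : ‖(1 : Matrix (Tor M × Fin d) (Tor M × Fin d) ℂ)‖ ≤ 1 :=
    opNorm_le_of_offDiag_eq_zero _ zero_le_one (fun i j hij => Matrix.one_apply_ne hij) (fun i => by rw [Matrix.one_apply_eq]; simp)
  rw [QvOp_mul_shiftT_sub_one, norm_smul, norm_inv, Complex.norm_natCast]
  refine mul_le_mul_of_nonneg_left ?_ hn0
  refine (Matrix.l2_opNorm_mul _ _).trans ?_
  refine mul_le_mul ((norm_sub_le _ _).trans (add_le_add (BalabanLineAverage.opNorm_shiftT_le M 1) h1 |>.trans (le_of_eq (by norm_num))))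
    ((opNorm_kron_le (Fin d) _).trans (opNorm_QsOp_le n M)) (norm_nonneg _) (by norm_num)

/-- **the NORMALISED averaging** `B_n := √(n^d)·Q_n` (so that `a·B_nᴴB_n = a·Q*_nQ_n`, the summand of `Δ_a` (1.69)). [folklore] -/
def Bav : Matrix (Tor M × Fin d) (Tor (fine n M) × Fin d) ℂ := ((((Real.sqrt ((n : ℝ) ^ d)) : ℝ) : ℂ)) • QvOp n M

/-- `‖B_n‖ ≤ 1`. [folklore] -/
theorem opNorm_Bav_le : ‖Bav n M‖ ≤ 1 := by
  have hnpos : (0 : ℝ) < (n : ℝ) ^ d := pow_pos (by exact_mod_cast Nat.pos_of_ne_zero (NeZero.ne n)) d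
  have hs0 : 0 < Real.sqrt ((n : ℝ) ^ d) := Real.sqrt_pos.mpr hnpos
  rw [Bav, norm_smul, Complex.norm_real, Real.norm_of_nonneg hs0.le]
  calc Real.sqrt ((n : ℝ) ^ d) * ‖QvOp n M‖ ≤ Real.sqrt ((n : ℝ) ^ d) * (Real.sqrt ((n : ℝ) ^ d))⁻¹ :=
        mul_le_mul_of_nonneg_left (opNorm_QvOp_le n M) hs0.le
    _ = 1 := mul_inv_cancel₀ hs0.ne'

omit [NeZero n] in
/-- **Gram identity**: `B_nᴴ B_n = Q*_n Q_n` with B5's weighted adjoint `Q* = n^d·Qᴴ` (`B5DeltaA169.QvAdj`), i.e. the `aQ*Q`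
summand of `Δ_a` is `a·B_nᴴB_n`. [cite: Balaban1984PropagatorsI, (1.69) p.29] [folklore] -/
theorem conjTranspose_Bav_mul_Bav : (Bav n M)ᴴ * Bav n M = QvAdj n M * QvOp n M := by
  obtain ⟨hs, hss⟩ := KingPairingPlantedLaw.sqrt_facts (d := d) n
  rw [Bav, Matrix.conjTranspose_smul, hs, Matrix.smul_mul, Matrix.mul_smul, smul_smul, hss, QvAdj, Matrix.smul_mul]

/-- **THE PAIRING DEFECT IS A BOUNDARY TERM**: `B_{L·n} J_L − B_n = c_L·B_n(S_1 − 1)` EXACTLY. [folklore] -/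
theorem Bav_succ_mul_JK_sub : Bav (L * n) M * JK n L M - Bav n M = cL L • (Bav n M * (shiftT (fine n M) 1 - 1)) := by
  have hLn : Real.sqrt (((L * n : ℕ) : ℝ) ^ d) = Real.sqrt ((n : ℝ) ^ d) * Real.sqrt ((L : ℝ) ^ d) := by
    rw [← Real.sqrt_mul (pow_nonneg (Nat.cast_nonneg _) d)]
    congr 1; push_cast; ring
  rw [Bav, Bav, hLn, Complex.ofReal_mul, ← smul_smul, Matrix.smul_mul, Matrix.smul_mul, sqrt_smul_QvOp_mul_JK n L M,
    Matrix.mul_add, Matrix.mul_one, Matrix.mul_smul, smul_add, add_sub_cancel_left, Matrix.smul_mul]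
  exact smul_comm _ _ _

/-- **THE PAIRING DEFECT IS `O(η)` IN OPERATOR NORM**: `‖B_{L·n}J_L − B_n‖ ≤ n⁻¹` (no sandwich needed; `|c_L| ≤ ½`,
`‖√(n^d)·Q_n(S_1 − 1)‖ ≤ 2n⁻¹`). [folklore] -/
theorem opNorm_Bav_succ_mul_JK_sub_le : ‖Bav (L * n) M * JK n L M - Bav n M‖ ≤ ((n : ℝ))⁻¹ := by
  have hL : 0 < L := Nat.pos_of_ne_zero (NeZero.ne L)
  have hnpos : (0 : ℝ) < (n : ℝ) ^ d := pow_pos (by exact_mod_cast Nat.pos_of_ne_zero (NeZero.ne n)) d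
  have hs0 : 0 < Real.sqrt ((n : ℝ) ^ d) := Real.sqrt_pos.mpr hnpos
  have hn0 : (0 : ℝ) ≤ ((n : ℝ))⁻¹ := inv_nonneg.mpr (Nat.cast_nonneg _)
  rw [Bav_succ_mul_JK_sub, norm_smul, Bav, Matrix.smul_mul, norm_smul, Complex.norm_real, Real.norm_of_nonneg hs0.le]
  calc ‖cL L‖ * (Real.sqrt ((n : ℝ) ^ d) * ‖QvOp n M * (shiftT (fine n M) 1 - 1)‖)
      ≤ 1 / 2 * (Real.sqrt ((n : ℝ) ^ d) * (((n : ℝ))⁻¹ * (2 * (Real.sqrt ((n : ℝ) ^ d))⁻¹))) :=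
        mul_le_mul (norm_cL_le L hL) (mul_le_mul_of_nonneg_left (opNorm_QvOp_mul_shiftT_sub_one_le n M) hs0.le)
          (mul_nonneg hs0.le (norm_nonneg _)) (by norm_num)
    _ = ((n : ℝ))⁻¹ := by field_simp

end Norm

/-! ## §2 Along the tower `n_k = L^k`: the inner-pairing data `(b, f) = (1, Cst·L^{−k})` of Bałaban's `B_k`, and `averagingLaws_Bfree` -/

section Tower

variable (L : ℕ) [NeZero L] (M : Fin d → ℕ) [hM : ∀ μ, NeZero (M μ)] (a : ℝ) (ha : 0 < a)

/-- Bałaban's normalised `k`-fold (1.18) averaging `B_k = √(n_k^d)·Q_k : ℓ²(T_{L^{−k}}; ℂ^d) → ℓ²(T₁; ℂ^d)`, typed on the tower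
index sets. [cite: Balaban1984PropagatorsI, (1.18) p.20] [folklore] -/
def BavT (k : ℕ) : Matrix (Tor M × Fin d) (idx L M k) ℂ := Bav (lev L k) M

/-- `‖B_k‖ ≤ 1` (`b = 1`). [folklore] -/
theorem opNorm_BavT_le (k : ℕ) : ‖BavT L M k‖ ≤ 1 := opNorm_Bav_le (lev L k) M

omit [NeZero L] in
/-- Gram identity along the tower: `B_kᴴB_k = Q*_kQ_k`, the averaging summand of `Δ_a^{(k)}` (`calDalev`, via
`B5DeltaA169.calDa_eq_DeltaA`). [cite: Balaban1984PropagatorsI, (1.69) p.29] [folklore] -/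
theorem conjTranspose_BavT_mul_BavT (k : ℕ) : (BavT L M k)ᴴ * BavT L M k = QvAdj (lev L k) M * QvOp (lev L k) M :=
  conjTranspose_Bav_mul_Bav (lev L k) M

/-- the exact defect along the tower: `B_{k+1}J_k − B_k = c_L·B_k(S_1 − 1)`. [folklore] -/
theorem BavT_succ_mul_JpcT_sub (k : ℕ) :
    BavT L M (k + 1) * JpcT L M k - BavT L M k = cL L • (BavT L M k * (shiftT (fine (lev L k) M) 1 - 1)) :=
  Bav_succ_mul_JK_sub (lev L k) L M

/-- the un-sandwiched defect along the tower: `‖B_{k+1}J_k − B_k‖ ≤ L^{−k}`. [folklore] -/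
theorem opNorm_BavT_succ_mul_JpcT_sub_le (k : ℕ) : ‖BavT L M (k + 1) * JpcT L M k - BavT L M k‖ ≤ ((L : ℝ)⁻¹) ^ k := by
  have h := opNorm_Bav_succ_mul_JK_sub_le (lev L k) L M
  rw [cast_lev', ← inv_pow] at h
  exact h

/-- **THE FREE INNER-PAIRING LAW `f` OF BAŁABAN's AVERAGING, right-sandwiched**: `‖(B_{k+1}J_k − B_k)(Δ_a^{(k)})⁻¹‖ ≤ Cst·L^{−k}`
— the datum `f_k` of the Gram shape for the `aQ_k(U)ᴴQ_k(U) − aQ_kᴴQ_k` summand (row B3.b of `t4/SKELETON-NE2-P1.md`), at `U = 1`,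
GEOMETRIC, from (1.89) `‖𝒢‖ ≤ Cst` only. [cite: Balaban1984PropagatorsI, (1.18) p.20, Prop. 1.1 (1.89) p.33; King1986, p.664] [folklore] -/
theorem opNorm_pairing_defect_calDalev_le (k : ℕ) :
    ‖(BavT L M (k + 1) * JpcT L M k - BavT L M k) * (calDalev L M a ha k)⁻¹‖ ≤ Cst d a * ((L : ℝ)⁻¹) ^ k := by
  refine (Matrix.l2_opNorm_mul _ _).trans ?_
  rw [mul_comm]
  exact mul_le_mul (KingPairingPlantedLaw.opNorm_inv_calDalev_le L M a ha k) (opNorm_BavT_succ_mul_JpcT_sub_le L M k)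
    (norm_nonneg _) (Cst_nonneg d a)

/-- the same, left-sandwiched: `‖(Δ_a^{(k)})⁻¹(B_{k+1}J_k − B_k)ᴴ‖ ≤ Cst·L^{−k}`. [folklore] -/
theorem opNorm_calDalev_inv_mul_pairing_defect_le (k : ℕ) :
    ‖(calDalev L M a ha k)⁻¹ * (BavT L M (k + 1) * JpcT L M k - BavT L M k)ᴴ‖ ≤ Cst d a * ((L : ℝ)⁻¹) ^ k := by
  have e : (calDalev L M a ha k)⁻¹ * (BavT L M (k + 1) * JpcT L M k - BavT L M k)ᴴ
      = ((BavT L M (k + 1) * JpcT L M k - BavT L M k) * (calDalev L M a ha k)⁻¹)ᴴ := by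
    rw [Matrix.conjTranspose_mul, conjTranspose_inv_calDalev]
  rw [e, Matrix.l2_opNorm_conjTranspose]
  exact opNorm_pairing_defect_calDalev_le L M a ha k

/-- **`AveragingLaws` FOR BAŁABAN's FREE INNER AVERAGING (unlifted)**: `b = 1`, `f_k = Cst·L^{−k}`. [folklore] -/
theorem averagingLaws_BavT : AveragingLaws (calDalev L M a ha) (BavT L M) (JpcT L M) 1 (fun k => Cst d a * ((L : ℝ)⁻¹) ^ k) where
  opNorm_le := opNorm_BavT_le L M
  pair_mul_inv_le := opNorm_pairing_defect_calDalev_le L M a ha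
  inv_mul_pair_le := opNorm_calDalev_inv_mul_pairing_defect_le L M a ha

/-! ### Colour-lifted: the row-B3.a′ supplier `averagingLaws_Bfree` -/

variable {o : Type*} [Fintype o] [DecidableEq o]

omit [NeZero L] hM [Fintype o] in
/-- leaf-07's lifted free averaging IS the lift of `B_k`: `Bfree L M k = B_k ⊗ 1`. [folklore] -/
theorem Bfree_eq_kron (k : ℕ) : Bfree (o := o) L M k = BavT L M k ⊗ₖ (1 : Matrix o o ℂ) := by
  rw [Bfree, BavT, Bav, sqrtVol, Matrix.smul_kronecker]

/-- the lifted defect `(B_{k+1} ⊗ 1)(J_k ⊗ 1) − B_k ⊗ 1 = (B_{k+1}J_k − B_k) ⊗ 1`. [folklore] -/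
theorem Bfree_succ_mul_kron_sub (k : ℕ) :
    Bfree (o := o) L M (k + 1) * (JpcT L M k ⊗ₖ (1 : Matrix o o ℂ)) - Bfree L M k
      = (BavT L M (k + 1) * JpcT L M k - BavT L M k) ⊗ₖ (1 : Matrix o o ℂ) := by
  rw [Bfree_eq_kron, Bfree_eq_kron, ← kron_mul, ← sub_kronecker]

/-- **ROW B3.a′ ∕ B3.d OF `t4/formal/NE2/LEAVES.md` — THE FREE INNER-AVERAGING LAWS OF `Bfree`** against the lifted free tower
`Δ_a^{(k)} ⊗ 1` and King's lifted pairing `J_k ⊗ 1`: size `1`, sandwiched two-level pairing `Cst(d,a)·L^{−k}` (both sides). [folklore] -/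
theorem averagingLaws_Bfree :
    AveragingLaws (fun k => calDalev L M a ha k ⊗ₖ (1 : Matrix o o ℂ)) (Bfree (o := o) L M)
      (fun k => JpcT L M k ⊗ₖ (1 : Matrix o o ℂ)) 1 (fun k => Cst d a * ((L : ℝ)⁻¹) ^ k) where
  opNorm_le := opNorm_Bfree_le L M
  pair_mul_inv_le := fun k => by
    rw [Bfree_succ_mul_kron_sub, kron_inv, ← kron_mul]
    exact (opNorm_kron_le o _).trans (opNorm_pairing_defect_calDalev_le L M a ha k)
  inv_mul_pair_le := fun k => by
    rw [Bfree_succ_mul_kron_sub, kron_inv, kron_conjTranspose, ← kron_mul]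
    exact (opNorm_kron_le o _).trans (opNorm_calDalev_inv_mul_pairing_defect_le L M a ha k)

end Tower

end Summit.QuantumFields.BalabanUV.T4Continuum.LineAveragingPairing

end
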